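import Literature.Geometry.Lorentzian.StationaryOrbitSpace
import Literature.Geometry.Lorentzian.StationaryOrbitSlice
import HarnessLib

/-!
# The orbit space of a chronological stationary space-time is a smooth manifold
(Anderson 2000, §0: "`S` is a smooth 3-manifold … Hausdorff and paracompact")

M. T. Anderson, *On stationary vacuum solutions to the Einstein equations*, Ann. Henri Poincaré 1
(2000), §0: "Let `S` be the orbit space of the action `G` [`≈ ℝ`, generated by the stationary
Killing field `X`]. Then `S` is a smooth 3-manifold and the projection `π : M → S` is a principle
`ℝ`-bundle, with fiber `G`. The chronology condition implies that `S` is Hausdorff and paracompact,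
c.f. [Ha]." This file completes the formalisation of this sentence begun in
`StationaryOrbitRelation.lean` (closed orbit relation, no early returns), `StationaryOrbitSpace.lean`
(the quotient `OrbitSpace X`, `π = orbitProj X`, Hausdorff, second countable) and
`StationaryOrbitSlice.lean` (local slices of the flow): it puts the **smooth structure** on
`S = M/G`.

* `LorentzianMetric.SliceData X θ F p` — the data of a local slice at `p` for the flow `θ`
  (flow-box chart `ψ`, functional `ℓ` with `ℓ(X p) = 1`, tube `T`, parameters `D₀`, and a linear
  chart `Φ : ker ℓ ≃ F` of the slice directions onto a fixed model space `F`, `dim F = dim M - 1`),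
  with the slice properties of `IsStationaryKilling.exists_slice`;
  `IsStationaryKilling.nonempty_sliceData` — it exists at every point of a chronological
  stationary space-time;
* `SliceData.param` (`u ↦ ψ⁻¹(ψ p + Φ⁻¹ u)`, the slice parametrised by `F`), `SliceData.coord`
  (`y ↦ Φ(P(ψ y - ψ p))`, the transversal coordinate of a tube point), `SliceData.dom`;
  `coord_param`, `orbitProj_param_coord` (the slice point with the coordinate of `y` lies on the
  orbit of `y`), `injOn_orbitProj_param` (the slice meets each orbit once), `isOpen_image_inter`;
* `SliceData.paramHomeo`, **`SliceData.chart`** — `π ∘ param` is an injective, continuous, open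
  map on the open set `dom`, hence an open partial homeomorphism `F → S`
  (`OpenPartialHomeomorph.ofContinuousOpenRestrict`), whose inverse is the **slice chart** of the
  orbit space at `π p`; `chart_apply_orbitProj : chart (π y) = coord y` on the tube;
* `SliceData.contDiffOn_chart_symm_trans_chart` — **the slice charts are `C^∞`-compatible**: about
  a parameter the transition map is `u ↦ coord'(θ(t₀, param u))` for a fixed flow time `t₀`, a
  composite of `C^∞` maps;
* `IsStationaryKilling.orbitSpaceChartedSpace` (the atlas of slice charts, a `ChartedSpace F`
  structure on `OrbitSpace X`; a `def`, depending on hypotheses and choices) and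
  **`IsStationaryKilling.isManifold_orbitSpace`** — `IsManifold 𝓘(ℝ, F) ∞ (OrbitSpace X)`
  (Mathlib's `isManifold_of_contDiffOn`);
* for a bundled `𝓢 : Spacetime 4`: a chosen flow `Spacetime.IsStationaryKilling.flow` of the
  complete Killing field with its defining properties, the charted space
  `Spacetime.IsStationaryKilling.orbitSpaceChartedSpace` modelled on `ℝ³ = EuclideanSpace ℝ (Fin 3)`,
  and **`Spacetime.IsStationaryKilling.isManifold_orbitSpace`**: under the hypotheses of
  `Anderson2000_completeStationaryVacuumFlat` concerning the group action (chronological,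
  complete Killing field timelike everywhere), `OrbitSpace X` is a `C^∞` manifold modelled on
  `𝓡 3`, Hausdorff, second countable and connected.

Not here: `π` as a smooth submersion / principal bundle map, and the quotient Riemannian metric
`g_S` (Anderson's orbit data `(S, g_S, u, θ)`, Lemma 1.1).

## Design

All statements about slices and charts are made for a smooth time-oriented Lorentzian manifold
modelled on a finite-dimensional normed space `E` with charts valued in `E` (`𝓘(ℝ, E)`, as for
`Spacetime d`), a flow `θ` of `X` given as data, and an arbitrary model `F` with
`dim F + 1 = dim E`; `SliceData` carries the minimal instances so that its API needs no Lorentzian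
hypotheses. The charted-space structures are `@[reducible] def`s, not instances.

## References

* M. T. Anderson, Ann. Henri Poincaré 1 (2000) 977–994, arXiv:gr-qc/0001091, §0 (key
  `Anderson2000`).
* J. M. Lee, *Introduction to Smooth Manifolds*, 2nd ed., GTM 218 (2012), Thm. 9.22 (flow box),
  Thm. 21.10 (quotient manifold theorem: slice charts) (key `LeeSmoothManifolds2013`).
* S. Harris, *Conformally stationary spacetimes*, Class. Quantum Grav. 9 (1992) 1823–1827
  (Anderson's [Ha]).
-/

noncomputable section

open Bundle Set Filter Function Manifold TopologicalSpace
open scoped ContDiff Topology Manifold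

namespace Literature.Geometry.Lorentzian

namespace LorentzianMetric

/-! ### Slice data and the charts of the orbit space -/

section Charts

variable {E : Type*} [NormedAddCommGroup E] [NormedSpace ℝ E] {M : Type*} [TopologicalSpace M]
  [ChartedSpace E M] (X : Π x : M, TangentSpace 𝓘(ℝ, E) x) (θ : ℝ × M → M)
  (F : Type*) [NormedAddCommGroup F] [NormedSpace ℝ F]

/-- **Slice data at a point `p`** for the flow `θ` of the vector field `X`, with linear model `F`
for the orbit space: a flow-box chart `ψ`, a functional `ℓ` with `ℓ(X p) = 1`, a size `ε > 0`, an
open tube `T ∋ p` in the box, an open parameter set `D₀ ∋ 0`, and a linear chart `Φ : ker ℓ ≃ F` of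
the slice directions, with the four slice properties of `IsStationaryKilling.exists_slice` (slice
in the tube, flow = translation on the tube, retraction onto the slice, slice meets each orbit
once). This is the data of a local trivialisation of the orbit-space projection `π : M → S` about
`p` (Anderson 2000, §0: `π` "is a principle `ℝ`-bundle"; Lee 2012, Thm. 21.10).
[cite: Anderson2000, §0] -/
structure SliceData (p : M) where
  /-- The flow-box chart. -/
  ψ : OpenPartialHomeomorph M E
  /-- The functional normalised on `X p`. -/
  ℓ : E →L[ℝ] ℝ
  /-- The flow-time size of the box. -/
  ε : ℝ
  /-- The tube. -/
  T : Set M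
  /-- The parameters of the slice. -/
  D₀ : Set E
  /-- The linear chart of the slice directions `ker ℓ`. -/
  Φ : (LinearMap.ker (ℓ : E →ₗ[ℝ] ℝ)) ≃L[ℝ] F
  hψ : ψ ∈ IsManifold.maximalAtlas 𝓘(ℝ, E) ∞ M
  hℓ : ℓ (show E from X p) = 1
  hε : 0 < ε
  hTo : IsOpen T
  hpT : p ∈ T
  hTψ : T ⊆ ψ.source
  hD₀o : IsOpen D₀
  h0 : (0 : E) ∈ D₀
  slice_mem : ∀ w ∈ D₀, ℓ w = 0 → ψ p + w ∈ ψ.target ∧ ψ.symm (ψ p + w) ∈ T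
  box : ∀ y ∈ T, ∀ s ∈ Ioo (-ε) ε,
    θ (s, y) ∈ ψ.source ∧ ψ (θ (s, y)) = ψ y + s • (show E from X p)
  retract : ∀ y ∈ T, |ℓ (ψ y - ψ p)| < ε ∧
    (ψ y - ψ p) - ℓ (ψ y - ψ p) • (show E from X p) ∈ D₀ ∧
    θ (-ℓ (ψ y - ψ p), y) = ψ.symm (ψ p + ((ψ y - ψ p) - ℓ (ψ y - ψ p) • (show E from X p)))
  once : ∀ w ∈ D₀, ℓ w = 0 → ∀ w' ∈ D₀, ℓ w' = 0 → ∀ t : ℝ,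
    θ (t, ψ.symm (ψ p + w)) = ψ.symm (ψ p + w') → t = 0 ∧ w = w'

variable {X θ F}

namespace SliceData

variable {p : M} (d : SliceData X θ F p)

/-- Vectors of the slice directions are killed by `ℓ`. [folklore] -/
theorem apply_coe_symm (u : F) :
    d.ℓ ((d.Φ.symm u : LinearMap.ker (d.ℓ : E →ₗ[ℝ] ℝ)) : E) = 0 :=
  (d.Φ.symm u).2

/-- The **projection onto the slice directions** `P z = z - ℓ(z) · X p ∈ ker ℓ` (a continuous
linear map `E → ker ℓ`). [folklore] -/
def proj : E →L[ℝ] LinearMap.ker (d.ℓ : E →ₗ[ℝ] ℝ) :=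
  (ContinuousLinearMap.id ℝ E - d.ℓ.smulRight (show E from X p)).codRestrict _ fun z ↦ by
    rw [LinearMap.mem_ker]
    change d.ℓ (z - d.ℓ z • (show E from X p)) = 0
    rw [map_sub, map_smul, d.hℓ, smul_eq_mul, mul_one, sub_self]

/-- `P z = z - ℓ(z) · X p`. [folklore] -/
@[simp] theorem coe_proj (z : E) : (d.proj z : E) = z - d.ℓ z • (show E from X p) := rfl

/-- The **slice parametrised by the model `F`**: `u ↦ ψ⁻¹(ψ p + Φ⁻¹ u)`. [cite: Anderson2000, §0] -/
def param (u : F) : M :=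
  d.ψ.symm (d.ψ p + ((d.Φ.symm u : LinearMap.ker (d.ℓ : E →ₗ[ℝ] ℝ)) : E))

/-- The **transversal coordinate** of a point of the tube: `Φ(P(ψ y - ψ p))`. [cite: Anderson2000, §0] -/
def coord (y : M) : F :=
  d.Φ (d.proj (d.ψ y - d.ψ p))

/-- The **chart domain** in the model `F`: the parameters whose slice point is defined. [folklore] -/
def dom : Set F :=
  {u | ((d.Φ.symm u : LinearMap.ker (d.ℓ : E →ₗ[ℝ] ℝ)) : E) ∈ d.D₀}

/-- The chart domain is open. [folklore] -/
theorem isOpen_dom : IsOpen d.dom :=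
  d.hD₀o.preimage (continuous_subtype_val.comp d.Φ.symm.continuous)

/-- `0` lies in the chart domain. [folklore] -/
theorem zero_mem_dom : (0 : F) ∈ d.dom := by
  simp only [dom, mem_setOf_eq, map_zero, ZeroMemClass.coe_zero]
  exact d.h0

/-- The slice passes through `p` at parameter `0`. [folklore] -/
theorem param_zero : d.param 0 = p := by
  simp only [param, map_zero, ZeroMemClass.coe_zero, add_zero]
  exact d.ψ.left_inv (d.hTψ d.hpT)

/-- Points of the slice lie in the chart target and in the tube. [folklore] -/
theorem param_mem {u : F} (hu : u ∈ d.dom) :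
    d.ψ p + ((d.Φ.symm u : LinearMap.ker (d.ℓ : E →ₗ[ℝ] ℝ)) : E) ∈ d.ψ.target ∧ d.param u ∈ d.T :=
  d.slice_mem _ hu (d.apply_coe_symm u)

/-- **The coordinate of a slice point is its parameter**: `coord (param u) = u` on the chart domain.
[folklore] -/
theorem coord_param {u : F} (hu : u ∈ d.dom) : d.coord (d.param u) = u := by
  have hw := d.param_mem hu
  simp only [coord, param] at hw ⊢
  rw [d.ψ.right_inv hw.1, add_sub_cancel_left]
  have : d.proj ((d.Φ.symm u : LinearMap.ker (d.ℓ : E →ₗ[ℝ] ℝ)) : E) = d.Φ.symm u := by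
    apply Subtype.ext
    rw [coe_proj, d.apply_coe_symm u, zero_smul, sub_zero]
  rw [this, d.Φ.apply_symm_apply]

/-- The coordinate of a tube point lies in the chart domain. [folklore] -/
theorem coord_mem_dom {y : M} (hy : y ∈ d.T) : d.coord y ∈ d.dom := by
  simp only [dom, coord, mem_setOf_eq, ContinuousLinearEquiv.symm_apply_apply, coe_proj]
  exact (d.retract y hy).2.1

/-- **The slice point with the coordinate of `y` lies on the orbit of `y`** (`y` in the tube): it
is `θ(-ℓ(ψ y - ψ p), y)` by the retraction property. [cite: Anderson2000, §0] -/
theorem orbitProj_param_coord (hθX : ∀ q, IsMIntegralCurve (fun t ↦ θ (t, q)) X)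
    (hθ0 : ∀ q, θ (0, q) = q) {y : M} (hy : y ∈ d.T) :
    orbitProj X (d.param (d.coord y)) = orbitProj X y := by
  have h3 := (d.retract y hy).2.2
  have : d.param (d.coord y) = θ (-d.ℓ (d.ψ y - d.ψ p), y) := by
    rw [h3]
    simp only [param, coord, ContinuousLinearEquiv.symm_apply_apply, coe_proj]
  rw [this]
  exact (orbitProj_eq_of_mem X ⟨fun t ↦ θ (t, y), hθX y, hθ0 y, _, rfl⟩).symm

/-- The slice parametrisation is continuous on the chart domain. [folklore] -/
theorem continuousOn_param : ContinuousOn d.param d.dom := by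
  refine d.ψ.continuousOn_symm.comp (Continuous.continuousOn ?_) (fun u hu ↦ (d.param_mem hu).1)
  exact continuous_const.add (continuous_subtype_val.comp d.Φ.symm.continuous)

/-- The transversal coordinate is continuous on the tube. [folklore] -/
theorem continuousOn_coord : ContinuousOn d.coord d.T :=
  (d.Φ.continuous.comp d.proj.continuous).comp_continuousOn
    ((d.ψ.continuousOn.mono d.hTψ).sub continuousOn_const)

/-- The source of the would-be chart is the `π`-image of the slice, which is the `π`-image of the
tube `T`. [folklore] -/
theorem image_orbitProj_param_dom (hθX : ∀ q, IsMIntegralCurve (fun t ↦ θ (t, q)) X)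
    (hθ0 : ∀ q, θ (0, q) = q) :
    (fun u ↦ orbitProj X (d.param u)) '' d.dom = orbitProj X '' d.T := by
  ext z
  constructor
  · rintro ⟨u, hu, rfl⟩
    exact ⟨d.param u, (d.param_mem hu).2, rfl⟩
  · rintro ⟨y, hy, rfl⟩
    exact ⟨d.coord y, d.coord_mem_dom hy, d.orbitProj_param_coord hθX hθ0 hy⟩

variable [IsManifold 𝓘(ℝ, E) ∞ M] [T2Space M]

/-- **`π ∘ param` is injective on the chart domain**: the slice meets each orbit once.
[cite: Anderson2000, §0] -/
theorem injOn_orbitProj_param (hX1 : CMDiff 1 (T% X))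
    (hθX : ∀ q, IsMIntegralCurve (fun t ↦ θ (t, q)) X) (hθ0 : ∀ q, θ (0, q) = q) :
    InjOn (fun u ↦ orbitProj X (d.param u)) d.dom := by
  intro u hu u' hu' huu'
  have hc : IsCompleteVectorField X := fun x ↦ ⟨fun t ↦ θ (t, x), hθX x, hθ0 x⟩
  have hmem := (orbitProj_eq_iff X hX1 hc).1 huu'
  obtain ⟨t, ht⟩ := (mem_stationaryOrbit_singleton_iff_exists_flow_eq hX1 hθX hθ0).1 hmem
  have hw := (d.once _ hu (d.apply_coe_symm u) _ hu' (d.apply_coe_symm u') t ht).2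
  exact d.Φ.symm.injective (Subtype.ext hw)

variable [CompleteSpace E]

/-- **Images of open parameter sets are open in the orbit space**: `π(param(dom ∩ O))` is the
`π`-image of the open part of the tube with coordinate in `dom ∩ O`. [cite: Anderson2000, §0] -/
theorem isOpen_image_inter (hX1 : CMDiff 1 (T% X))
    (hθX : ∀ q, IsMIntegralCurve (fun t ↦ θ (t, q)) X) (hθ0 : ∀ q, θ (0, q) = q) {O : Set F}
    (hO : IsOpen O) : IsOpen ((fun u ↦ orbitProj X (d.param u)) '' (d.dom ∩ O)) := by
  have hc : IsCompleteVectorField X := fun x ↦ ⟨fun t ↦ θ (t, x), hθX x, hθ0 x⟩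
  have heq : (fun u ↦ orbitProj X (d.param u)) '' (d.dom ∩ O) =
      orbitProj X '' (d.T ∩ d.coord ⁻¹' (d.dom ∩ O)) := by
    ext z
    constructor
    · rintro ⟨u, ⟨hu, huO⟩, rfl⟩
      refine ⟨d.param u, ⟨(d.param_mem hu).2, ?_⟩, rfl⟩
      show d.coord (d.param u) ∈ d.dom ∩ O
      rw [d.coord_param hu]
      exact ⟨hu, huO⟩
    · rintro ⟨y, ⟨hyT, hyc⟩, rfl⟩
      exact ⟨d.coord y, hyc, d.orbitProj_param_coord hθX hθ0 hyT⟩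
  rw [heq]
  exact isOpenMap_orbitProj X hX1 hc _
    (d.continuousOn_coord.isOpen_inter_preimage d.hTo (d.isOpen_dom.inter hO))

/-- The restriction of `π ∘ param` to the chart domain is an open map. [folklore] -/
theorem isOpenMap_restrict_orbitProj_param (hX1 : CMDiff 1 (T% X))
    (hθX : ∀ q, IsMIntegralCurve (fun t ↦ θ (t, q)) X) (hθ0 : ∀ q, θ (0, q) = q) :
    IsOpenMap (d.dom.restrict fun u ↦ orbitProj X (d.param u)) := by
  intro s hs
  obtain ⟨O, hO, rfl⟩ := isOpen_induced_iff.1 hs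
  have : (d.dom.restrict fun u ↦ orbitProj X (d.param u)) '' (Subtype.val ⁻¹' O) =
      (fun u ↦ orbitProj X (d.param u)) '' (d.dom ∩ O) := by
    ext z
    simp only [mem_image, mem_preimage, restrict_apply, Subtype.exists, mem_inter_iff,
      exists_prop]
    constructor
    · rintro ⟨u, hu, huO, rfl⟩
      exact ⟨u, ⟨hu, huO⟩, rfl⟩
    · rintro ⟨u, ⟨hu, huO⟩, rfl⟩
      exact ⟨u, hu, huO, rfl⟩
  rw [this]
  exact d.isOpen_image_inter hX1 hθX hθ0 hO

/-- **The slice parametrisation as an open partial homeomorphism `F → S`** onto an open set of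
the orbit space (injective on the open chart domain, continuous, open). [cite: Anderson2000, §0] -/
def paramHomeo (hX1 : CMDiff 1 (T% X))
    (hθX : ∀ q, IsMIntegralCurve (fun t ↦ θ (t, q)) X) (hθ0 : ∀ q, θ (0, q) = q) :
    OpenPartialHomeomorph F (OrbitSpace X) :=
  OpenPartialHomeomorph.ofContinuousOpenRestrict
    ((d.injOn_orbitProj_param hX1 hθX hθ0).toPartialEquiv (fun u ↦ orbitProj X (d.param u)) d.dom)
    ((continuous_orbitProj X).comp_continuousOn d.continuousOn_param)
    (d.isOpenMap_restrict_orbitProj_param hX1 hθX hθ0) d.isOpen_dom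

/-- **The orbit-space chart at `π p` defined by the slice**: the inverse of the slice
parametrisation, an open partial homeomorphism `S → F`. Anderson 2000, §0 ("`S` is a smooth
3-manifold"): these are its charts. [cite: Anderson2000, §0] -/
def chart (hX1 : CMDiff 1 (T% X))
    (hθX : ∀ q, IsMIntegralCurve (fun t ↦ θ (t, q)) X) (hθ0 : ∀ q, θ (0, q) = q) :
    OpenPartialHomeomorph (OrbitSpace X) F :=
  (d.paramHomeo hX1 hθX hθ0).symm

/-- The source of the chart at `p` is the `π`-image of the tube `T`. [folklore] -/
theorem chart_source (hX1 : CMDiff 1 (T% X))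
    (hθX : ∀ q, IsMIntegralCurve (fun t ↦ θ (t, q)) X) (hθ0 : ∀ q, θ (0, q) = q) :
    (d.chart hX1 hθX hθ0).source = orbitProj X '' d.T :=
  d.image_orbitProj_param_dom hθX hθ0

/-- `π p` lies in the source of the chart at `p`. [folklore] -/
theorem mem_chart_source (hX1 : CMDiff 1 (T% X))
    (hθX : ∀ q, IsMIntegralCurve (fun t ↦ θ (t, q)) X) (hθ0 : ∀ q, θ (0, q) = q) :
    orbitProj X p ∈ (d.chart hX1 hθX hθ0).source := by
  rw [d.chart_source hX1 hθX hθ0]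
  exact ⟨p, d.hpT, rfl⟩

/-- **The chart reads off the transversal coordinate**: `chart (π y) = coord y = Φ(P(ψ y - ψ p))`
for every `y` in the tube (well defined on orbits because the slice meets each orbit once).
[cite: Anderson2000, §0] -/
theorem chart_apply_orbitProj (hX1 : CMDiff 1 (T% X))
    (hθX : ∀ q, IsMIntegralCurve (fun t ↦ θ (t, q)) X) (hθ0 : ∀ q, θ (0, q) = q) {y : M}
    (hy : y ∈ d.T) : d.chart hX1 hθX hθ0 (orbitProj X y) = d.coord y := by
  have h1 : orbitProj X y = d.paramHomeo hX1 hθX hθ0 (d.coord y) :=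
    (d.orbitProj_param_coord hθX hθ0 hy).symm
  rw [h1]
  exact (d.paramHomeo hX1 hθX hθ0).left_inv (d.coord_mem_dom hy)

/-- The chart is inverse to the slice parametrisation on the chart domain: `chart (π (param u)) = u`.
[folklore] -/
theorem chart_apply_orbitProj_param (hX1 : CMDiff 1 (T% X))
    (hθX : ∀ q, IsMIntegralCurve (fun t ↦ θ (t, q)) X) (hθ0 : ∀ q, θ (0, q) = q) {u : F}
    (hu : u ∈ d.dom) : d.chart hX1 hθX hθ0 (orbitProj X (d.param u)) = u :=
  (d.paramHomeo hX1 hθX hθ0).left_inv hu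

/-- The inverse chart is the slice parametrisation followed by `π`. [folklore] -/
theorem chart_symm_apply (hX1 : CMDiff 1 (T% X))
    (hθX : ∀ q, IsMIntegralCurve (fun t ↦ θ (t, q)) X) (hθ0 : ∀ q, θ (0, q) = q) (u : F) :
    (d.chart hX1 hθX hθ0).symm u = orbitProj X (d.param u) := rfl

/-- The target of the chart at `p` is the chart domain `dom`. [folklore] -/
theorem chart_target (hX1 : CMDiff 1 (T% X))
    (hθX : ∀ q, IsMIntegralCurve (fun t ↦ θ (t, q)) X) (hθ0 : ∀ q, θ (0, q) = q) :
    (d.chart hX1 hθX hθ0).target = d.dom := rfl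

/-! #### Smoothness of the slice maps and of the transition maps -/

omit [IsManifold 𝓘(ℝ, E) ∞ M] [T2Space M] [CompleteSpace E] in
/-- The slice parametrisation is `C^∞` on the chart domain (affine map followed by the inverse
flow-box chart). [folklore] -/
theorem contMDiffOn_param : ContMDiffOn 𝓘(ℝ, F) 𝓘(ℝ, E) ∞ d.param d.dom := by
  have hA : ContMDiff 𝓘(ℝ, F) 𝓘(ℝ, E) ∞
      (fun u : F ↦ d.ψ p + ((d.Φ.symm u : LinearMap.ker (d.ℓ : E →ₗ[ℝ] ℝ)) : E)) := by
    rw [contMDiff_iff_contDiff]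
    change ContDiff ℝ ∞ (fun u : F ↦ d.ψ p +
      ((Submodule.subtypeL _).comp (d.Φ.symm : F →L[ℝ] LinearMap.ker (d.ℓ : E →ₗ[ℝ] ℝ))) u)
    exact contDiff_const.add (ContinuousLinearMap.contDiff _)
  exact (contMDiffOn_symm_of_mem_maximalAtlas d.hψ).comp hA.contMDiffOn
    (fun u hu ↦ (d.param_mem hu).1)

omit [IsManifold 𝓘(ℝ, E) ∞ M] [T2Space M] [CompleteSpace E] in
/-- The transversal coordinate is `C^∞` on the tube (flow-box chart followed by an affine map).
[folklore] -/
theorem contMDiffOn_coord : ContMDiffOn 𝓘(ℝ, E) 𝓘(ℝ, F) ∞ d.coord d.T := by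
  have hB : ContMDiff 𝓘(ℝ, E) 𝓘(ℝ, F) ∞ (fun z : E ↦ d.Φ (d.proj (z - d.ψ p))) := by
    rw [contMDiff_iff_contDiff]
    change ContDiff ℝ ∞ (fun z : E ↦
      ((d.Φ : LinearMap.ker (d.ℓ : E →ₗ[ℝ] ℝ) →L[ℝ] F).comp d.proj) (z - d.ψ p))
    exact (ContinuousLinearMap.contDiff _).comp (contDiff_id.sub contDiff_const)
  exact hB.comp_contMDiffOn ((contMDiffOn_of_mem_maximalAtlas d.hψ).mono d.hTψ)

/-- **The transition maps between slice charts are `C^∞`.** For slice data `d` at `p` and `d'` at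
`q` of a `C^∞` flow, the change of charts `d'.chart ∘ d.chart⁻¹` is `C^∞` on its domain: about a
parameter `u₀` it is `u ↦ coord'(θ(t₀, param u))` for a fixed flow time `t₀` carrying the slice
point of `u₀` into the tube of `d'` (slice parametrisation, flow map and coordinate are `C^∞`,
and charts read off coordinates of tube points, `chart_apply_orbitProj`). This is the smooth
compatibility of the orbit-space atlas (Anderson 2000, §0: "`S` is a smooth 3-manifold").
[cite: Anderson2000, §0] -/
theorem contDiffOn_chart_symm_trans_chart {q : M} (d' : SliceData X θ F q) (hX1 : CMDiff 1 (T% X))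
    (hθ : ContMDiff (𝓘(ℝ, ℝ).prod 𝓘(ℝ, E)) 𝓘(ℝ, E) ∞ θ)
    (hθX : ∀ q, IsMIntegralCurve (fun t ↦ θ (t, q)) X) (hθ0 : ∀ q, θ (0, q) = q) :
    ContDiffOn ℝ ∞ ((d.chart hX1 hθX hθ0).symm ≫ₕ d'.chart hX1 hθX hθ0)
      ((d.chart hX1 hθX hθ0).symm ≫ₕ d'.chart hX1 hθX hθ0).source := by
  have hc : IsCompleteVectorField X := fun x ↦ ⟨fun t ↦ θ (t, x), hθX x, hθ0 x⟩
  apply contDiffOn_of_locally_contDiffOn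
  intro u₀ hu₀
  rw [OpenPartialHomeomorph.trans_source] at hu₀
  obtain ⟨hu₀d, hu₀'⟩ := hu₀
  -- `u₀ ∈ dom d` and `π (param u₀) ∈ π '' T'`
  change u₀ ∈ d.dom at hu₀d
  rw [mem_preimage, d'.chart_source hX1 hθX hθ0] at hu₀'
  change orbitProj X (d.param u₀) ∈ orbitProj X '' d'.T at hu₀'
  obtain ⟨y₀, hy₀T, hy₀⟩ := hu₀'
  obtain ⟨t₀, ht₀⟩ := (mem_stationaryOrbit_singleton_iff_exists_flow_eq hX1 hθX hθ0).1
    ((orbitProj_eq_iff X hX1 hc).1 hy₀.symm)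
  -- the local model `G u = coord' (θ (t₀, param u))` on the open set `W`
  set W : Set F := d.dom ∩ (fun u ↦ θ (t₀, d.param u)) ⁻¹' d'.T with hW
  have hθt : ContMDiff 𝓘(ℝ, E) 𝓘(ℝ, E) ∞ (fun x : M ↦ θ (t₀, x)) :=
    hθ.comp (contMDiff_const.prodMk contMDiff_id)
  have h12 : ContMDiffOn 𝓘(ℝ, F) 𝓘(ℝ, E) ∞ (fun u ↦ θ (t₀, d.param u)) d.dom :=
    hθt.comp_contMDiffOn d.contMDiffOn_param
  have hWo : IsOpen W := h12.continuousOn.isOpen_inter_preimage d.isOpen_dom d'.hTo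
  have hu₀W : u₀ ∈ W := ⟨hu₀d, by show θ (t₀, d.param u₀) ∈ d'.T; rw [ht₀]; exact hy₀T⟩
  have hG : ContMDiffOn 𝓘(ℝ, F) 𝓘(ℝ, F) ∞ (fun u ↦ d'.coord (θ (t₀, d.param u))) W :=
    d'.contMDiffOn_coord.comp (h12.mono inter_subset_left) (fun u hu ↦ hu.2)
  refine ⟨W, hWo, hu₀W, ?_⟩
  refine ((contMDiffOn_iff_contDiffOn.1 hG).mono inter_subset_right).congr ?_
  -- on `W` the transition map is `G`
  rintro u ⟨-, huW⟩
  rw [OpenPartialHomeomorph.coe_trans, comp_apply, d.chart_symm_apply hX1 hθX hθ0,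
    orbitProj_eq_of_mem X ⟨fun t ↦ θ (t, d.param u), hθX _, hθ0 _, t₀, rfl⟩]
  exact d'.chart_apply_orbitProj hX1 hθX hθ0 huW.2

end SliceData

end Charts

/-! ### Existence of slice data in a chronological stationary space-time -/

section Existence

variable {E : Type*} [NormedAddCommGroup E] [NormedSpace ℝ E] [FiniteDimensional ℝ E]
  [CompleteSpace E] {M : Type*} [TopologicalSpace M] [ChartedSpace E M]
  [IsManifold 𝓘(ℝ, E) ∞ M] [T2Space M]
  {g : LorentzianMetric 𝓘(ℝ, E) ∞ M} [g.HasLeviCivita] {τ : TimeOrientation g}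
  {X : Π x : M, TangentSpace 𝓘(ℝ, E) x} {θ : ℝ × M → M}
  {F : Type*} [NormedAddCommGroup F] [NormedSpace ℝ F] [FiniteDimensional ℝ F]

omit [CompleteSpace E] [IsManifold 𝓘(ℝ, E) ∞ M] [T2Space M] [g.HasLeviCivita]
  [FiniteDimensional ℝ F] in
/-- The kernel of a functional with `ℓ v = 1` has dimension `dim E - 1`. [folklore] -/
theorem finrank_ker_add_one_of_apply_eq_one {ℓ : E →L[ℝ] ℝ} {v : E} (hℓ : ℓ v = 1) :
    Module.finrank ℝ (LinearMap.ker (ℓ : E →ₗ[ℝ] ℝ)) + 1 = Module.finrank ℝ E := by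
  have hr : LinearMap.range (ℓ : E →ₗ[ℝ] ℝ) = ⊤ := by
    rw [eq_top_iff]
    rintro c -
    refine ⟨c • v, ?_⟩
    simp [hℓ]
  have h := LinearMap.finrank_range_add_finrank_ker (ℓ : E →ₗ[ℝ] ℝ)
  rw [hr, finrank_top, Module.finrank_self] at h
  omega

/-- **Existence of slice data** at every point of a chronological stationary space-time, for any
linear model `F` of dimension `dim E - 1` (`IsStationaryKilling.exists_slice` and a linear chart
`ker ℓ ≃ F`, Mathlib's `ContinuousLinearEquiv.ofFinrankEq`). Anderson 2000, §0 (local triviality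
of `π`). [cite: Anderson2000, §0] -/
theorem IsStationaryKilling.nonempty_sliceData (h : g.IsStationaryKilling τ X univ)
    (hchr : g.IsChronological τ) (hθ : ContMDiff (𝓘(ℝ, ℝ).prod 𝓘(ℝ, E)) 𝓘(ℝ, E) 2 θ)
    (hθ0 : ∀ p, θ (0, p) = p) (hθadd : ∀ t s p, θ (t, θ (s, p)) = θ (t + s, p))
    (hθX : ∀ p, IsMIntegralCurve (fun t ↦ θ (t, p)) X)
    (hF : Module.finrank ℝ F + 1 = Module.finrank ℝ E) (p : M) :
    Nonempty (SliceData X θ F p) := by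
  obtain ⟨ψ, hψ, ℓ, ε, hε, T, D₀, hℓ, hTo, hpT, hTψ, hD₀o, h0, h1, h2, h3, h4⟩ :=
    h.exists_slice hchr hθ hθ0 hθadd hθX p
  have hdim : Module.finrank ℝ (LinearMap.ker (ℓ : E →ₗ[ℝ] ℝ)) = Module.finrank ℝ F := by
    have := finrank_ker_add_one_of_apply_eq_one hℓ
    omega
  exact ⟨SliceData.mk ψ ℓ ε T D₀ (ContinuousLinearEquiv.ofFinrankEq hdim) hψ hℓ hε hTo hpT hTψ
    hD₀o h0 h1 h2 h3 h4⟩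

end Existence

/-! ### The orbit space as a topological manifold: a charted space modelled on `F` -/

section ChartedSpace

variable {E : Type*} [NormedAddCommGroup E] [NormedSpace ℝ E] [FiniteDimensional ℝ E]
  [CompleteSpace E] {M : Type*} [TopologicalSpace M] [ChartedSpace E M]
  [IsManifold 𝓘(ℝ, E) ∞ M] [T2Space M]
  {g : LorentzianMetric 𝓘(ℝ, E) ∞ M} [g.HasLeviCivita] {τ : TimeOrientation g}
  {X : Π x : M, TangentSpace 𝓘(ℝ, E) x} {θ : ℝ × M → M}
  {F : Type*} [NormedAddCommGroup F] [NormedSpace ℝ F] [FiniteDimensional ℝ F]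

/-- **A choice of slice data at every point** of a chronological stationary space-time
(`nonempty_sliceData` and the axiom of choice). [cite: Anderson2000, §0] -/
def IsStationaryKilling.sliceDataAt (h : g.IsStationaryKilling τ X univ)
    (hchr : g.IsChronological τ) (hθ : ContMDiff (𝓘(ℝ, ℝ).prod 𝓘(ℝ, E)) 𝓘(ℝ, E) 2 θ)
    (hθ0 : ∀ p, θ (0, p) = p) (hθadd : ∀ t s p, θ (t, θ (s, p)) = θ (t + s, p))
    (hθX : ∀ p, IsMIntegralCurve (fun t ↦ θ (t, p)) X)
    (hF : Module.finrank ℝ F + 1 = Module.finrank ℝ E) (p : M) : SliceData X θ F p :=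
  Classical.choice (h.nonempty_sliceData hchr hθ hθ0 hθadd hθX hF p)

/-- **The orbit space of a chronological stationary space-time is a topological manifold**
modelled on `F` (`dim F = dim M - 1`): the charted-space structure on `S = M/G` whose chart at the
orbit of `p` is the slice chart at (a representative) `p` — Anderson 2000, §0: "`S` is a smooth
3-manifold … The chronology condition implies that `S` is Hausdorff and paracompact"
(Hausdorff: `IsStationaryKilling.t2Space_orbitSpace`; second countable:
`secondCountableTopology_orbitSpace`; the smooth compatibility of these charts is the subject of
the sequel). A `def` and not an `instance`: it depends on the hypotheses and on choices.
[cite: Anderson2000, §0] -/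
@[reducible]
def IsStationaryKilling.orbitSpaceChartedSpace (h : g.IsStationaryKilling τ X univ)
    (hchr : g.IsChronological τ) (hθ : ContMDiff (𝓘(ℝ, ℝ).prod 𝓘(ℝ, E)) 𝓘(ℝ, E) 2 θ)
    (hθ0 : ∀ p, θ (0, p) = p) (hθadd : ∀ t s p, θ (t, θ (s, p)) = θ (t + s, p))
    (hθX : ∀ p, IsMIntegralCurve (fun t ↦ θ (t, p)) X)
    (hF : Module.finrank ℝ F + 1 = Module.finrank ℝ E) : ChartedSpace F (OrbitSpace X) where
  atlas := range fun p : M ↦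
    (h.sliceDataAt hchr hθ hθ0 hθadd hθX hF p).chart h.contMDiff_one hθX hθ0
  chartAt z := (h.sliceDataAt hchr hθ hθ0 hθadd hθX hF z.out).chart h.contMDiff_one hθX hθ0
  mem_chart_source z := by
    have hm := (h.sliceDataAt hchr hθ hθ0 hθadd hθX hF z.out).mem_chart_source
      h.contMDiff_one hθX hθ0
    have hz : orbitProj X z.out = z := Quotient.out_eq z
    rwa [hz] at hm
  chart_mem_atlas z := ⟨z.out, rfl⟩

/-- In the charted-space structure of the orbit space, the chart at the orbit of `p` has the orbit
in its source, and every chart of the atlas is a slice chart. [folklore] -/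
theorem IsStationaryKilling.chartAt_orbitSpace_eq (h : g.IsStationaryKilling τ X univ)
    (hchr : g.IsChronological τ) (hθ : ContMDiff (𝓘(ℝ, ℝ).prod 𝓘(ℝ, E)) 𝓘(ℝ, E) 2 θ)
    (hθ0 : ∀ p, θ (0, p) = p) (hθadd : ∀ t s p, θ (t, θ (s, p)) = θ (t + s, p))
    (hθX : ∀ p, IsMIntegralCurve (fun t ↦ θ (t, p)) X)
    (hF : Module.finrank ℝ F + 1 = Module.finrank ℝ E) (z : OrbitSpace X) :
    letI := h.orbitSpaceChartedSpace hchr hθ hθ0 hθadd hθX hF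
    chartAt F z = (h.sliceDataAt hchr hθ hθ0 hθadd hθX hF z.out).chart h.contMDiff_one hθX hθ0 :=
  rfl

/-- **The orbit space of a chronological stationary space-time is a smooth manifold** of
dimension `dim M - 1` (Anderson 2000, §0: "`S` is a smooth 3-manifold"; Hausdorff by
`IsStationaryKilling.t2Space_orbitSpace`, second countable by `secondCountableTopology_orbitSpace`):
with the charted-space structure `orbitSpaceChartedSpace` of a `C^∞` flow, the slice charts are
`C^∞`-compatible (`SliceData.contDiffOn_chart_symm_trans_chart`), so `S` is a `C^∞` manifold
modelled on `𝓘(ℝ, F)`. [cite: Anderson2000, §0] -/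
theorem IsStationaryKilling.isManifold_orbitSpace (h : g.IsStationaryKilling τ X univ)
    (hchr : g.IsChronological τ) (hθ : ContMDiff (𝓘(ℝ, ℝ).prod 𝓘(ℝ, E)) 𝓘(ℝ, E) ∞ θ)
    (hθ0 : ∀ p, θ (0, p) = p) (hθadd : ∀ t s p, θ (t, θ (s, p)) = θ (t + s, p))
    (hθX : ∀ p, IsMIntegralCurve (fun t ↦ θ (t, p)) X)
    (hF : Module.finrank ℝ F + 1 = Module.finrank ℝ E) :
    letI := h.orbitSpaceChartedSpace hchr (hθ.of_le (WithTop.coe_le_coe.mpr le_top)) hθ0 hθadd hθX hF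
    IsManifold 𝓘(ℝ, F) ∞ (OrbitSpace X) := by
  letI := h.orbitSpaceChartedSpace hchr (hθ.of_le (WithTop.coe_le_coe.mpr le_top)) hθ0 hθadd hθX hF
  refine isManifold_of_contDiffOn 𝓘(ℝ, F) ∞ (OrbitSpace X) ?_
  rintro e e' ⟨p, rfl⟩ ⟨q, rfl⟩
  simp only [modelWithCornersSelf_coe, modelWithCornersSelf_coe_symm, CompTriple.comp_eq,
    preimage_id_eq, id_eq, range_id, inter_univ]
  exact SliceData.contDiffOn_chart_symm_trans_chart _ _ h.contMDiff_one hθ hθX hθ0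

end ChartedSpace

end LorentzianMetric

/-! ### The bundled form: the orbit space of a stationary `Spacetime 4` is a smooth 3-manifold -/

universe u

namespace Spacetime

variable {𝓢 : Spacetime.{u} 4} [𝓢.metric.HasLeviCivita]
  {X : Π x : 𝓢.carrier, TangentSpace (𝓡 4) x}

/-- `2 ≤ ∞` in `ℕ∞ω`. [folklore] -/
private lemma two_le_infty : (2 : ℕ∞ω) ≤ ∞ := WithTop.coe_le_coe.mpr le_top

/-- The flow data of a complete smooth Killing field of a spacetime: a `C^∞` global flow with the
group law whose curves are the integral curves
(`Literature.Geometry.Manifold.exists_contMDiff_globalFlow_of_complete`, Lee 2012, Thm. 9.12).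
Anderson 2000, §0 ("a smooth 1-parameter group `G ≈ ℝ` of isometries"). [cite: Anderson2000, §0] -/
theorem IsStationaryKilling.exists_flow (hX : 𝓢.IsStationaryKilling X univ) :
    ∃ θ : ℝ × 𝓢.carrier → 𝓢.carrier, ContMDiff (𝓘(ℝ, ℝ).prod (𝓡 4)) (𝓡 4) ∞ θ ∧
      (∀ p, θ (0, p) = p) ∧ (∀ t s p, θ (t, θ (s, p)) = θ (t + s, p)) ∧
      ∀ p, IsMIntegralCurve (fun t ↦ θ (t, p)) X := by
  have hV : ContMDiff (𝓡 4) (𝓡 4).tangent (⊤ : ℕ∞)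
      (fun x ↦ (⟨x, X x⟩ : TangentBundle (𝓡 4) 𝓢.carrier)) := hX.isKillingField.contMDiff
  have hc : ∀ x : 𝓢.carrier, ∃ γ : ℝ → 𝓢.carrier, γ 0 = x ∧ IsMIntegralCurve γ X := fun x ↦ by
    obtain ⟨γ, hγ, h0⟩ := hX.isCompleteVectorField x
    exact ⟨γ, h0, hγ⟩
  obtain ⟨θ, hθ, h0, hadd, hint⟩ :=
    Literature.Geometry.Manifold.exists_contMDiff_globalFlow_of_complete hV
      (by exact_mod_cast le_top) hc
  exact ⟨θ, by exact_mod_cast hθ, h0, hadd, hint⟩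

/-- **A chosen flow** `θ : ℝ × M → M` of the complete stationary Killing field of a spacetime
(the one-parameter group `G ≈ ℝ`, Anderson 2000, §0; chosen from `exists_flow`).
[cite: Anderson2000, §0] -/
def IsStationaryKilling.flow (hX : 𝓢.IsStationaryKilling X univ) : ℝ × 𝓢.carrier → 𝓢.carrier :=
  Classical.choose hX.exists_flow

/-- The chosen flow is `C^∞`. [folklore] -/
theorem IsStationaryKilling.contMDiff_flow (hX : 𝓢.IsStationaryKilling X univ) :
    ContMDiff (𝓘(ℝ, ℝ).prod (𝓡 4)) (𝓡 4) ∞ hX.flow :=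
  (Classical.choose_spec hX.exists_flow).1

/-- The chosen flow starts at the identity: `θ(0, p) = p`. [folklore] -/
theorem IsStationaryKilling.flow_zero (hX : 𝓢.IsStationaryKilling X univ) (p : 𝓢.carrier) :
    hX.flow (0, p) = p :=
  (Classical.choose_spec hX.exists_flow).2.1 p

/-- The group law of the chosen flow: `θ(t, θ(s, p)) = θ(t + s, p)`. [folklore] -/
theorem IsStationaryKilling.flow_add (hX : 𝓢.IsStationaryKilling X univ) (t s : ℝ)
    (p : 𝓢.carrier) : hX.flow (t, hX.flow (s, p)) = hX.flow (t + s, p) :=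
  (Classical.choose_spec hX.exists_flow).2.2.1 t s p

/-- The curves of the chosen flow are the integral curves of `X`. [folklore] -/
theorem IsStationaryKilling.isMIntegralCurve_flow (hX : 𝓢.IsStationaryKilling X univ)
    (p : 𝓢.carrier) : IsMIntegralCurve (fun t ↦ hX.flow (t, p)) X :=
  (Classical.choose_spec hX.exists_flow).2.2.2 p

/-- `dim ℝ³ + 1 = dim ℝ⁴`. [folklore] -/
private lemma finrank_three_add_one :
    Module.finrank ℝ (EuclideanSpace ℝ (Fin 3)) + 1 =
      Module.finrank ℝ (EuclideanSpace ℝ (Fin 4)) := by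
  simp [finrank_euclideanSpace]

/-- **The charted-space structure of the orbit space of a chronological stationary spacetime**,
modelled on `ℝ³ = EuclideanSpace ℝ (Fin 3)`: the slice charts of the chosen flow
(`LorentzianMetric.IsStationaryKilling.orbitSpaceChartedSpace`). Anderson 2000, §0 ("`S` is a
smooth 3-manifold"). [cite: Anderson2000, §0] -/
@[reducible]
def IsStationaryKilling.orbitSpaceChartedSpace (hX : 𝓢.IsStationaryKilling X univ)
    (hchr : 𝓢.metric.IsChronological 𝓢.timeOrientation) :
    ChartedSpace (EuclideanSpace ℝ (Fin 3)) (OrbitSpace X) :=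
  LorentzianMetric.IsStationaryKilling.orbitSpaceChartedSpace hX hchr
    (hX.contMDiff_flow.of_le two_le_infty) hX.flow_zero hX.flow_add hX.isMIntegralCurve_flow
    finrank_three_add_one

/-- **Anderson 2000, §0, for a bundled spacetime: the orbit space `S = M/G` of a chronological
stationary spacetime is a smooth, Hausdorff, second countable, connected 3-manifold.** Under the
hypotheses of `Anderson2000_completeStationaryVacuumFlat` that concern the group action — a
four-dimensional chronological spacetime with a complete Killing field timelike at every point —
`OrbitSpace X` with the slice charts of the stationary flow is a `C^∞` manifold modelled on `ℝ³`
("Then `S` is a smooth 3-manifold … The chronology condition implies that `S` is Hausdorff and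
paracompact"). [cite: Anderson2000, §0] -/
theorem IsStationaryKilling.isManifold_orbitSpace (hX : 𝓢.IsStationaryKilling X univ)
    (hchr : 𝓢.metric.IsChronological 𝓢.timeOrientation) :
    letI := hX.orbitSpaceChartedSpace hchr
    IsManifold (𝓡 3) ∞ (OrbitSpace X) ∧ T2Space (OrbitSpace X) ∧
      SecondCountableTopology (OrbitSpace X) ∧ ConnectedSpace (OrbitSpace X) :=
  ⟨LorentzianMetric.IsStationaryKilling.isManifold_orbitSpace hX hchr hX.contMDiff_flow
      hX.flow_zero hX.flow_add hX.isMIntegralCurve_flow finrank_three_add_one,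
    hX.t2Space_orbitSpace hchr,
    secondCountableTopology_orbitSpace X hX.contMDiff_one hX.isCompleteVectorField,
    connectedSpace_orbitSpace X⟩

end Spacetime

end Literature.Geometry.Lorentzian

end
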